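import Summits.CriticalPhenomena.PercolationContinuityZ3.Theorems.Transplant.SharpnessGridCoarse
import Summits.CriticalPhenomena.PercolationContinuityZ3.Theorems.Transplant.SharpnessGridWedge
import Literature.Probability.Percolation.ConstrainedClusters
import Mathlib.Data.Pi.Interval
import HarnessLib

/-!
# The subdivided square lattice `ℤ²[L_M]`: open clusters versus coarse open clusters

House module of the `TransplantSharpness` programme (sharpness desk, row 84).  `L_M = gridLines M` is the union of
the grid lines of mesh `M`; the induced subgraph `ℤ²[L_M]` is the square lattice with every edge subdivided into
`M` edges in series (junctions `M x`, `x ∈ ℤ²`).  For a configuration `ω` on `ℤ²` let `C` be the open cluster of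
`0` in the COARSE configuration `coarseConfig M ω` (`SharpnessGridCoarse`: the coarse edge `{x, x + e_j}` is open
iff the `M` edges of its wall are open) and `C'` the open cluster of `0` for percolation restricted to the steps of
`ℤ²` inside `L_M` (`openClusterIn (withinGraph ℤ² L_M)`, Literature `ConstrainedClusters`).  Deterministically:

* `M • C ⊆ C'` (an open coarse edge is an open wall of `M` lattice edges inside `L_M`), so `C` infinite ⇒ `C'`
  infinite (`openClusterIn_gridLines_infinite`);
* every vertex of `C'` lies within `ℓ∞`-distance `< M` of a junction `M x` with `x ∈ C` (induction along an open
  path: inside a segment a lattice step either advances, retreats, or completes the wall — a perpendicular step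
  leaves `L_M`), so `C'` infinite ⇒ `C` infinite (`coarseCluster_infinite`).

Hence the percolation events coincide: `percolatesVia (withinGraph ℤ² L_M) 0 = coarseConfig M ⁻¹' percolatesAt 0`
(`percolatesVia_gridLines_eq`), the deterministic half of `θ_{ℤ²[L_M]}(0, p) = θ_{ℤ²}(0, p^M)`
(`SharpnessSubdividedLattice`, with the series law of `SharpnessSeriesLaw`).
-/

noncomputable section

namespace Summit.CriticalPhenomena.PercolationContinuityZ3.Theorems.TransplantSharpness

open Literature.Probability.Percolation Literature.Probability.LatticeModels

/-! ## Segment points -/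

/-- The point `M x + c e_j` of the grid line through the junction `M x` in direction `j` (house notation). -/
def segPt (M : ℕ) (x : Site 2) (j : Fin 2) (c : ℤ) : Site 2 := (M : ℤ) • x + Pi.single j c

/-- `segPt M x j 0 = M x`. [folklore] -/
@[simp] theorem segPt_zero (M : ℕ) (x : Site 2) (j : Fin 2) : segPt M x j 0 = (M : ℤ) • x := by
  simp [segPt]

/-- One more step along the line. [folklore] -/
theorem segPt_add_single (M : ℕ) (x : Site 2) (j : Fin 2) (c d : ℤ) :
    segPt M x j c + Pi.single j d = segPt M x j (c + d) := by
  simp [segPt, add_assoc, Pi.single_add]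

/-- Re-basing a segment point at the neighbouring junction. [folklore] -/
theorem segPt_base_shift (M : ℕ) (x : Site 2) (j : Fin 2) (a b : ℤ) :
    (M : ℤ) • (x + Pi.single j a) + Pi.single j b = segPt M x j ((M : ℤ) * a + b) := by
  ext k
  rcases eq_or_ne k j with rfl | hk
  · simp only [segPt, Pi.add_apply, Pi.smul_apply, smul_eq_mul, Pi.single_eq_same]; ring
  · simp [segPt, Pi.single_eq_of_ne hk]

/-- The far end of a wall is the next junction: `M x + (s M) e_j = M (x + s e_j)`. [folklore] -/
theorem segPt_mul_eq_smul (M : ℕ) (x : Site 2) (j : Fin 2) (s : ℤ) :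
    segPt M x j (s * M) = (M : ℤ) • (x + Pi.single j s) := by
  have h := segPt_base_shift M x j s 0
  rw [Pi.single_zero, add_zero] at h
  rw [h, mul_comm, add_zero]

/-- Segment points lie on the grid lines. [folklore] -/
theorem segPt_mem_gridLines (M : ℕ) (x : Site 2) (j : Fin 2) (c : ℤ) : segPt M x j c ∈ gridLines M := by
  fin_cases j
  · right; simp [segPt]
  · left; simp [segPt]

/-- Segment points with distinct parameters are distinct. [folklore] -/
theorem segPt_injective (M : ℕ) (x : Site 2) (j : Fin 2) : Function.Injective (segPt M x j) := by
  intro c d h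
  have := congr_fun h j
  simpa [segPt] using this

/-- Consecutive segment points are adjacent in `ℤ²`. [folklore] -/
theorem segPt_adj_succ (M : ℕ) (x : Site 2) (j : Fin 2) (c : ℤ) :
    (zdGraph 2).Adj (segPt M x j c) (segPt M x j (c + 1)) := by
  rw [zdGraph_adj_iff]
  exact ⟨j, Or.inl (segPt_add_single M x j c 1).symm⟩

/-- A lattice step is `± e_j`. [folklore] -/
theorem exists_step_of_adj {v w : Site 2} (h : (zdGraph 2).Adj v w) :
    ∃ (j : Fin 2) (s : ℤ), (s = 1 ∨ s = -1) ∧ w = v + Pi.single j s := by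
  obtain ⟨i, h | h⟩ := (zdGraph_adj_iff v w).1 h
  · exact ⟨i, 1, Or.inl rfl, h⟩
  · refine ⟨i, -1, Or.inr rfl, ?_⟩
    rw [h, add_assoc, ← Pi.single_add]
    simp

/-- A positive integer below `M` is not a multiple of `M`. [folklore] -/
theorem not_dvd_of_pos_of_lt {M : ℕ} {t : ℤ} (h0 : 0 < t) (hM : t < M) : ¬ (M : ℤ) ∣ t := fun h =>
  h0.ne' (Int.eq_zero_of_dvd_of_nonneg_of_lt h0.le hM h)

/-! ## From open walls to open coarse edges -/

/-- **A fully open wall opens its coarse edge** (both orientations `s = ±1` of the wall from the junction `M x`).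
[folklore] -/
theorem unitEdge_mem_coarseConfig_of_subEdges {M : ℕ} {ω : BondConfig (Site 2)} {x : Site 2} {j : Fin 2} {s : ℤ}
    (hs : s = 1 ∨ s = -1)
    (h : ∀ u : ℤ, 0 ≤ u → u < M → s(segPt M x j (s * u), segPt M x j (s * (u + 1))) ∈ ω) :
    s(x, x + Pi.single j s) ∈ coarseConfig M ω := by
  rcases hs with rfl | rfl
  · rw [unitEdge_mem_coarseConfig_iff]
    intro t ht
    have := h t (by positivity) (by exact_mod_cast ht)
    simp only [one_mul, segPt] at this
    exact this
  · -- re-base at `x' = x - e_j`: the wall of `{x', x' + e_j}` read backwards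
    set x' : Site 2 := x + Pi.single j (-1) with hx'
    have hx : x = x' + Pi.single j 1 := by
      rw [hx', add_assoc, ← Pi.single_add]; simp
    rw [show s(x, x') = s(x', x' + Pi.single j (1 : ℤ)) by rw [← hx, Sym2.eq_swap], unitEdge_mem_coarseConfig_iff]
    intro t ht
    have hu0 : (0 : ℤ) ≤ (M : ℤ) - 1 - t := by omega
    have huM : (M : ℤ) - 1 - t < M := by omega
    have e1 : (M : ℤ) • x' + Pi.single j (t : ℤ) = segPt M x j (-1 * ((M : ℤ) - 1 - t + 1)) := by
      rw [hx', segPt_base_shift]; congr 1; ring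
    have e2 : (M : ℤ) • x' + Pi.single j ((t : ℤ) + 1) = segPt M x j (-1 * ((M : ℤ) - 1 - t)) := by
      rw [hx', segPt_base_shift]; congr 1; ring
    show s((M : ℤ) • x' + Pi.single j (t : ℤ), (M : ℤ) • x' + Pi.single j ((t : ℤ) + 1)) ∈ ω
    rw [e1, e2, Sym2.eq_swap]
    exact h _ hu0 huM

/-- One open coarse step extends the coarse cluster. [folklore] -/
theorem mem_coarseCluster_of_adj {M : ℕ} {ω : BondConfig (Site 2)} {x y : Site 2}
    (hx : x ∈ openCluster (coarseConfig M ω) 0) (he : s(x, y) ∈ coarseConfig M ω) (hne : x ≠ y) :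
    y ∈ openCluster (coarseConfig M ω) 0 := by
  change (openGraph (coarseConfig M ω)).Reachable 0 y
  exact SimpleGraph.Reachable.trans hx (SimpleGraph.Adj.reachable ((openGraph_adj _ _ _).2 ⟨he, hne⟩))

/-! ## Every vertex of the fine cluster is near a junction of the coarse cluster -/

/-- `v` is reached from a junction `M x` of the coarse cluster of `0` by an OPEN initial piece, of length `t < M`,
of the wall leaving `M x` in direction `s e_j`. House notation (the induction invariant). -/
def SegGood (M : ℕ) (ω : BondConfig (Site 2)) (v : Site 2) : Prop :=
  ∃ x : Site 2, x ∈ openCluster (coarseConfig M ω) 0 ∧ ∃ (j : Fin 2) (s : ℤ), (s = 1 ∨ s = -1) ∧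
    ∃ t : ℤ, 0 ≤ t ∧ t < M ∧ v = segPt M x j (s * t) ∧
      ∀ u : ℤ, 0 ≤ u → u < t → s(segPt M x j (s * u), segPt M x j (s * (u + 1))) ∈ ω

/-- The origin is good (it is a junction of its own coarse cluster). [folklore] -/
theorem segGood_zero {M : ℕ} (hM : 1 ≤ M) (ω : BondConfig (Site 2)) : SegGood M ω 0 :=
  ⟨0, mem_openCluster_self _ _, 0, 1, Or.inl rfl, 0, le_rfl, by exact_mod_cast hM, by simp, fun u hu hu' => by omega⟩

/-- **Advancing along an open wall**: from the good position `t` on the wall `(x, j, s)`, the open lattice step to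
position `t + 1` leads to a good vertex (a longer open initial piece, or — when `t + 1 = M` — the next junction,
which then belongs to the coarse cluster). [folklore] -/
theorem segGood_forward {M : ℕ} (hM : 1 ≤ M) {ω : BondConfig (Site 2)} {x : Site 2}
    (hx : x ∈ openCluster (coarseConfig M ω) 0) {j : Fin 2} {s : ℤ} (hs : s = 1 ∨ s = -1) {t : ℤ} (ht0 : 0 ≤ t)
    (htM : t < M) (hist : ∀ u : ℤ, 0 ≤ u → u < t → s(segPt M x j (s * u), segPt M x j (s * (u + 1))) ∈ ω)
    (hnew : s(segPt M x j (s * t), segPt M x j (s * (t + 1))) ∈ ω) :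
    SegGood M ω (segPt M x j (s * (t + 1))) := by
  have hist' : ∀ u : ℤ, 0 ≤ u → u < t + 1 → s(segPt M x j (s * u), segPt M x j (s * (u + 1))) ∈ ω := by
    intro u hu0 hut
    rcases lt_or_eq_of_le (Int.lt_add_one_iff.1 hut) with h | rfl
    · exact hist u hu0 h
    · exact hnew
  by_cases hlt : t + 1 < M
  · exact ⟨x, hx, j, s, hs, t + 1, by omega, hlt, rfl, hist'⟩
  · have heq : t + 1 = M := by omega
    -- the wall is complete: the coarse edge `{x, x + s e_j}` is open
    have hcoarse : s(x, x + Pi.single j s) ∈ coarseConfig M ω :=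
      unitEdge_mem_coarseConfig_of_subEdges hs fun u hu0 huM => hist' u hu0 (by omega)
    have hne : x ≠ x + Pi.single j s := by
      intro h
      have := congr_fun h j
      rcases hs with rfl | rfl <;> simp at this
    have hy := mem_coarseCluster_of_adj hx hcoarse hne
    refine ⟨x + Pi.single j s, hy, j, s, hs, 0, le_rfl, by exact_mod_cast hM, ?_, fun u hu hu' => by omega⟩
    rw [heq, segPt_mul_eq_smul, mul_zero, segPt_zero]

/-- **The induction step**: a good vertex joined by an open lattice step to a vertex of `L_M` leads to a good
vertex. [folklore] -/
theorem segGood_step {M : ℕ} (hM : 1 ≤ M) {ω : BondConfig (Site 2)} {v w : Site 2} (hv : SegGood M ω v)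
    (hadj : (zdGraph 2).Adj v w) (hw : w ∈ gridLines M) (hopen : s(v, w) ∈ ω) : SegGood M ω w := by
  obtain ⟨x, hx, j, s, hs, t, ht0, htM, rfl, hist⟩ := hv
  obtain ⟨j', s', hs', rfl⟩ := exists_step_of_adj hadj
  rcases eq_or_lt_of_le ht0 with rfl | htpos
  · -- at the junction `M x`: re-align the wall with the step taken
    have h0 : segPt M x j (s * 0) = segPt M x j' (s' * 0) := by simp
    rw [h0] at hopen ⊢
    rw [segPt_add_single, show s' * 0 + s' = s' * (0 + 1) by ring] at hopen ⊢
    exact segGood_forward hM hx hs' le_rfl (by exact_mod_cast hM) (fun u hu hu' => by omega) hopen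
  · rcases eq_or_ne j j' with rfl | hjj
    · rcases hs' with rfl | rfl <;> rcases hs with rfl | rfl
      · -- forward (`s = s' = 1`)
        rw [segPt_add_single, show (1 : ℤ) * t + 1 = 1 * (t + 1) by ring] at hopen ⊢
        exact segGood_forward hM hx (Or.inl rfl) ht0 htM hist hopen
      · -- backward (`s = -1`, `s' = 1`)
        rw [segPt_add_single, show (-1 : ℤ) * t + 1 = -1 * (t - 1) by ring]
        exact ⟨x, hx, j, -1, Or.inr rfl, t - 1, by omega, by omega, rfl, fun u hu0 hut => hist u hu0 (by omega)⟩
      · -- backward (`s = 1`, `s' = -1`)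
        rw [segPt_add_single, show (1 : ℤ) * t + -1 = 1 * (t - 1) by ring]
        exact ⟨x, hx, j, 1, Or.inl rfl, t - 1, by omega, by omega, rfl, fun u hu0 hut => hist u hu0 (by omega)⟩
      · -- forward (`s = s' = -1`)
        rw [segPt_add_single, show (-1 : ℤ) * t + -1 = -1 * (t + 1) by ring] at hopen ⊢
        exact segGood_forward hM hx (Or.inr rfl) ht0 htM hist hopen
    · -- a perpendicular step from the interior of a wall leaves `L_M`
      exfalso
      have hsj : ¬ (M : ℤ) ∣ (M : ℤ) * x j + s * t := by
        rw [dvd_add_right (dvd_mul_right _ _)]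
        rcases hs with rfl | rfl
        · rw [one_mul]; exact not_dvd_of_pos_of_lt htpos htM
        · rw [neg_one_mul, dvd_neg]; exact not_dvd_of_pos_of_lt htpos htM
      have hsj' : ¬ (M : ℤ) ∣ (M : ℤ) * x j' + s' := by
        rw [dvd_add_right (dvd_mul_right _ _)]
        have h1 : ¬ (M : ℤ) ∣ 1 := not_dvd_of_pos_of_lt one_pos (by omega)
        rcases hs' with rfl | rfl
        · exact h1
        · rw [dvd_neg]; exact h1
      simp only [gridLines, Set.mem_setOf_eq, segPt, Pi.add_apply, Pi.smul_apply, smul_eq_mul] at hw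
      fin_cases j <;> fin_cases j'
      · exact hjj rfl
      · simp at hw hsj hsj'
        rcases hw with h | h
        · exact hsj h
        · exact hsj' h
      · simp at hw hsj hsj'
        rcases hw with h | h
        · exact hsj' h
        · exact hsj h
      · exact hjj rfl

/-- **Every vertex of the fine cluster of `0` is good.** [folklore] -/
theorem segGood_of_mem_openClusterIn {M : ℕ} (hM : 1 ≤ M) {ω : BondConfig (Site 2)} {w : Site 2}
    (hw : w ∈ openClusterIn (withinGraph (zdGraph 2) (gridLines M)) ω 0) : SegGood M ω w := by
  rw [mem_openClusterIn_iff, SimpleGraph.reachable_iff_reflTransGen] at hw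
  induction hw with
  | refl => exact segGood_zero hM ω
  | tail _ hbc ih =>
    rw [SimpleGraph.inf_adj, openGraph_adj, withinGraph_adj] at hbc
    exact segGood_step hM ih hbc.2.1 hbc.2.2.2 hbc.1.1

/-- A good vertex lies within `ℓ∞`-distance `< M` of a junction of the coarse cluster. [folklore] -/
theorem near_junction_of_segGood {M : ℕ} {ω : BondConfig (Site 2)} {v : Site 2} (hv : SegGood M ω v) :
    ∃ x ∈ openCluster (coarseConfig M ω) 0,
      v ∈ Set.Icc ((M : ℤ) • x - fun _ => (M : ℤ)) ((M : ℤ) • x + fun _ => (M : ℤ)) := by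
  obtain ⟨x, hx, j, s, hs, t, ht0, htM, rfl, -⟩ := hv
  refine ⟨x, hx, ?_, ?_⟩
  · intro k
    simp only [segPt, Pi.sub_apply, Pi.add_apply, Pi.smul_apply, smul_eq_mul]
    rcases eq_or_ne k j with rfl | hk
    · rw [Pi.single_eq_same]; rcases hs with rfl | rfl <;> omega
    · rw [Pi.single_eq_of_ne hk]; omega
  · intro k
    simp only [segPt, Pi.add_apply, Pi.smul_apply, smul_eq_mul]
    rcases eq_or_ne k j with rfl | hk
    · rw [Pi.single_eq_same]; rcases hs with rfl | rfl <;> omega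
    · rw [Pi.single_eq_of_ne hk]; omega

/-- **If the fine cluster of `0` in `ℤ²[L_M]` is infinite, so is the coarse cluster of `0`.** [folklore] -/
theorem coarseCluster_infinite {M : ℕ} (hM : 1 ≤ M) {ω : BondConfig (Site 2)}
    (h : (openClusterIn (withinGraph (zdGraph 2) (gridLines M)) ω 0).Infinite) :
    (openCluster (coarseConfig M ω) 0).Infinite := by
  by_contra hfin
  rw [Set.not_infinite] at hfin
  apply h
  refine Set.Finite.subset (hfin.biUnion fun x _ =>
    Set.finite_Icc ((M : ℤ) • x - fun _ => (M : ℤ)) ((M : ℤ) • x + fun _ => (M : ℤ))) fun v hv => ?_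
  obtain ⟨x, hx, hvx⟩ := near_junction_of_segGood (segGood_of_mem_openClusterIn hM hv)
  exact Set.mem_biUnion hx hvx

/-! ## From the coarse cluster to the fine cluster -/

/-- An open wall is an open path of `ℤ²[L_M]`: the junction `M x` reaches every point of the open wall.
[folklore] -/
theorem reachable_segPt_of_wall {M : ℕ} {ω : BondConfig (Site 2)} {x : Site 2} {j : Fin 2}
    (hw : ∀ t : ℕ, t < M → wallEdge M x j t ∈ ω) :
    ∀ n : ℕ, n ≤ M → (openGraph ω ⊓ withinGraph (zdGraph 2) (gridLines M)).Reachable ((M : ℤ) • x) (segPt M x j n) := by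
  intro n
  induction n with
  | zero => intro _; simp
  | succ n ih =>
    intro hn
    refine (ih (Nat.le_of_succ_le hn)).trans (SimpleGraph.Adj.reachable ?_)
    rw [SimpleGraph.inf_adj, openGraph_adj, withinGraph_adj]
    have hstep : segPt M x j ((n + 1 : ℕ) : ℤ) = segPt M x j ((n : ℤ) + 1) := by push_cast; rfl
    rw [hstep]
    refine ⟨⟨hw n (Nat.lt_of_succ_le hn), fun h => ?_⟩, segPt_adj_succ M x j n, segPt_mem_gridLines _ _ _ _,
      segPt_mem_gridLines _ _ _ _⟩
    have := segPt_injective M x j h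
    omega

/-- **An open coarse path lifts to an open path of `ℤ²[L_M]` through the junctions**: `M • C ⊆ C'`. [folklore] -/
theorem smul_mem_openClusterIn_of_mem_coarseCluster {M : ℕ} {ω : BondConfig (Site 2)} {y : Site 2}
    (hy : y ∈ openCluster (coarseConfig M ω) 0) :
    (M : ℤ) • y ∈ openClusterIn (withinGraph (zdGraph 2) (gridLines M)) ω 0 := by
  rw [mem_openClusterIn_iff]
  change (openGraph (coarseConfig M ω)).Reachable 0 y at hy
  rw [SimpleGraph.reachable_iff_reflTransGen] at hy
  induction hy with
  | refl => simp
  | tail _ hbc ih =>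
    rename_i b c
    refine ih.trans ?_
    obtain ⟨⟨x, j, hxj, hwall⟩, -⟩ := (openGraph_adj _ _ _).1 hbc
    have hreach : (openGraph ω ⊓ withinGraph (zdGraph 2) (gridLines M)).Reachable ((M : ℤ) • x)
        ((M : ℤ) • (x + Pi.single j 1)) := by
      have h := reachable_segPt_of_wall hwall M le_rfl
      rwa [show segPt M x j ((M : ℕ) : ℤ) = (M : ℤ) • (x + Pi.single j 1) by rw [← segPt_mul_eq_smul, one_mul]] at h
    rcases Sym2.eq_iff.1 hxj with ⟨rfl, rfl⟩ | ⟨rfl, rfl⟩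
    · exact hreach
    · exact hreach.symm

/-- **If the coarse cluster of `0` is infinite, so is the fine cluster of `0` in `ℤ²[L_M]`** (`M ≥ 1`). [folklore] -/
theorem openClusterIn_gridLines_infinite {M : ℕ} (hM : 1 ≤ M) {ω : BondConfig (Site 2)}
    (h : (openCluster (coarseConfig M ω) 0).Infinite) :
    (openClusterIn (withinGraph (zdGraph 2) (gridLines M)) ω 0).Infinite := by
  have hinj : Set.InjOn (fun y : Site 2 => (M : ℤ) • y) (openCluster (coarseConfig M ω) 0) := by
    intro y _ y' _ hyy
    exact smul_right_injective (Site 2) (show (M : ℤ) ≠ 0 by omega) hyy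
  refine (h.image hinj).mono ?_
  rintro _ ⟨y, hy, rfl⟩
  exact smul_mem_openClusterIn_of_mem_coarseCluster hy

/-! ## The percolation events coincide -/

/-- **`0 ↔ ∞` in `ℤ²[L_M]` iff `0 ↔ ∞` in the coarse configuration** (`M ≥ 1`): the events are equal. [folklore] -/
theorem percolatesVia_gridLines_eq {M : ℕ} (hM : 1 ≤ M) :
    percolatesVia (withinGraph (zdGraph 2) (gridLines M)) (0 : Site 2) = coarseConfig M ⁻¹' percolatesAt 0 := by
  ext ω
  exact ⟨fun h => coarseCluster_infinite hM h, fun h => openClusterIn_gridLines_infinite hM h⟩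

end Summit.CriticalPhenomena.PercolationContinuityZ3.Theorems.TransplantSharpness
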